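import Mathlib
import HarnessLib
import Summits.HubbardSuperconductivity.HubbardSuperconductivity.Theorems.KLProgrammeKLRegimeBetaSplitV10S
import Summits.HubbardSuperconductivity.HubbardSuperconductivity.Theorems.KLProgrammeKLRegimeSplitBundleV15

/-!
# Route `KLProgramme` — crux K3 gen 6, CHILD 1 at the V15 bundle: `betaSplitP_klPredsV15 (W) : BetaSplitP klPredsV15 W`
# (cell gate-hubbard-kl, seat p2 g9 = bundle typist, plan g14 (g2) birth closers; the gen-6 child-1 decl `KLRegimeBetaSplitV15 := BetaSplitP klPredsV15 klWindowC`
# closes BY NAME with this theorem at `W := klWindowC` once the resplit renders it — route closer `--workitem <gen-6 child-1 id>` then)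

`klPredsV15` (`…SplitBundleV15`, p505393) has `split := BetaSplitAtS2` and `engine := EngineBoundsAtV10S` (T2, k3c2-p3's `…SplitEngineV10`), so child 1 is k3c2-p3's
`betaSplitP_of_slotsV10S` (`…BetaSplitV10S`, the (R-Dq) twin of k3c1-p2's `betaSplitP_of_slotsV9S`) with the two identity slot maps — exactly as
`betaSplitP_klPredsV14` was for gen 5.  The frame class and the two-leg slot are not read by child 1.  Everything is proved; nothing about the model is asserted.
-/

noncomputable section

namespace Summit.HubbardSuperconductivity.HubbardSuperconductivity.Theorems.KLRegimeSplit

set_option linter.dupNamespace false -- summit = problem name (single-conjunct summit), D-0017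

/-- **Child 1 at the V15 bundle, every covariance window.** -/
theorem betaSplitP_klPredsV15 (W : Set ℝ) : BetaSplitP klPredsV15 W :=
  betaSplitP_of_slotsV10S (Pr := klPredsV15) (fun _ _ _ _ _ _ _ _ _ _ _ _ h => h) (fun _ _ _ _ _ _ _ _ _ _ _ _ h => h)

end Summit.HubbardSuperconductivity.HubbardSuperconductivity.Theorems.KLRegimeSplit

end
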